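import Summits.QuantumFields.BalabanUV.Beta.FP.ExpLocalisedBubblePoint

/-!
# `BalabanUV.Beta.FP.NearRegionCrossBubbleLetters` — road «FP» (binder row D1), organisation β of `RHOA-DESIGN.md` §3, row RHOA-3 (N-PC generic), PART 1a:
# LATTICE-PATH LETTERS FOR THE CROSS BUBBLE — mixed second differences of a one-point `F` (on a box, near∕far) and of a two-point `R` (global letters), and the
# OUTER (‖z‖∞ ≥ 4) box∕penalty bookkeeping on `ℤ⁴` ([folklore] lattice bookkeeping; nothing of the manuscripts; no road object is typed or touched)

HONEST DEPENDENCY (page 1, mandatory): continuum YM on T⁴ ⇐ BetaPertH ∧ nine spine estimates (0/9 proved); BetaPertH ⇐ (D1) ∧ (D4) ∧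
CAP+tail; G-an2-4 gates asym, D1 and NE2/3/4.  HONEST FRAMING (cell contract, verbatim): «discharging `BetaPertH` makes Bałaban's UV
stability UNCONDITIONAL — a real constructive-QFT result; it is NOT the continuum limit and NOT the Clay problem.»  THIS MODULE is elementary [folklore]
real analysis on `ℤ^D` ∕ `ℤ⁴` in the H2-a currency of `FP/ExpLocalisedBubble{,Point}` (beta-d1-formalise-leaf-02 g6): lattice paths
`FP/LatticeTaylorPath.abs_taylor0D_le`, the near∕far split `ExpLocalisedBubble.abs_sub_le_near_far_pow`, the `ℤ⁴` box geometry of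
`FP/HorizontalBookkeepingTail.supNorm_le_add_of_box` and `ExpLocalisedBubblePoint.quarter_bounds`.  Every analytic input (the graded decay of `F` and of its differences,
the GLOBAL difference letters of `R`) is a HYPOTHESIS displayed in the signatures; the module cites nothing, defines nothing, mints no `Prop` fact, 0 sorry.  NOT the
road's `R^Q`∕`R^g`∕`P^{BF}`∕`Ḣ` (RHOA-8 instantiates), NOT `ρ_n` bounded, NOT `hasym`, NOT D1, NOT BetaPertH, NOT continuum, NOT Clay.

ROW (road FP owner d1-p3-g6, `RHOA-DESIGN.md` 7feeae18441b23f4 §3 (N-PC) ∕ §5 RHOA-3, `LEAVES-FP.md` l.309; R-FP-22 (a): organisation β binding): «ℤ⁴ power counting —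
legs `F` with `|∇^jF(z)| ≤ A(‖z‖∞+1)^{−2−j}` (j ≤ 2) and `R` with letters `|∇^jR(x,y)| ≤ B·n^{−2−j}`, exp-localised zero-moment vertex weights ⟹
`Σ_{0<‖z‖∞≤n}|bubble(F,R)(z)|·‖z‖² ≤ C·A·B` n-FREE».  THIS FILE = the letters; PART 1b `…Smear` = the double zero-mass identity; PART 1c `…Point` = the pointwise
bound; PART 2 `FP/NearRegionCrossBubble` = window sums + the `(R,R′)` and tadpole twins.

CONTENT ([folklore]).
* §1 `abs_mixedDiff_le_of_box` (the MIXED second difference `F(y+s+s′) − F(y+s) − F(y+s′) + F y` from unit second differences on a box — two nested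
  `abs_taylor0D_le`), `abs_mixedDiff_le_near_far` (its near∕far form with the `(|s|₁/ρ)^k` penalty); for a two-point `R` with GLOBAL letters: `abs_sub_fst_le`,
  `abs_sub_snd_le` (first differences in either argument along a path), `abs_mixedDiff₂_le` (ONE difference in EACH argument).
* §2 the outer bookkeeping on `ℤ⁴` (`‖z‖∞ ≥ 4`, near radius `2⌊‖z‖∞/4⌋`): `box_geometry_two` (`‖z‖∞+1 ≤ 2(‖t‖∞+1)` on the box), `succ_le_twenty_mul_quarter`,
  `div_pow_le_of_succ_le`, the box letters `fwdDiff_box_le` ∕ `fwdDiff₂_box_le` (`A_j·2^{a+j}/(‖z‖∞+1)^{a+j}`), and against letters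
  `L ≥ max(1,|s|₁)`: **`abs_sub_le_outer`** `|F(z+s) − F z| ≤ (4·A₁2^{a+1} + 2A₀·10^{a+1})/(‖z‖∞+1)^{a+1}·L^{a+2}`, **`abs_mixedDiff_le_outer`**
  `|F(z+x′−y) − F(z+x′) − F(z−y) + F z| ≤ (16·A₂2^{a+2} + 8A₀·20^{a+2})/(‖z‖∞+1)^{a+2}·L₀^{a+2}L₁^{a+2}`.
  NOTE FOR SUPPLIERS (R-FP-20): the only second-difference letter of `R` these files consume is the MIXED one (one step in each argument) — for `R^Q = A·G_C·Aᵀ`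
  that is `(ΔA)·G_C·(ΔA)ᵀ`, a product of FIRST differences of the block potential; the located edge-`log` of same-argument second differences never enters.
Unit `b2b-balaban-gan24-formalise-leaf-05` (gen 36; cross-lane idle G-an2-4 swarm leaf seat on road FP), 2026-08-20; journal INTENT ∕ CLAIM «RHOA-3» l.23369.
-/

noncomputable section

namespace Summit.QuantumFields.BalabanUV.Beta.FP.NearRegionCrossBubbleLetters

open Finset Filter Topology fwdDiff
open scoped BigOperators
open Literature.MathematicalPhysics.QuantumFieldTheory.Balaban1983to89
open Literature.MathematicalPhysics.QuantumFieldTheory.Balaban1983to89.Beta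
open B12Sec2to5 (l1 l1_nonneg abs_coord_le_l1)
open ExpKernelCalculus (Site Zl Zl_pos l1_sub_symm)
open Summit.QuantumFields.BalabanUV.Beta.FP.LatticeTaylorPath (abs_taylor0D_le)
open Summit.QuantumFields.BalabanUV.Beta.FP.HorizontalBookkeepingTail (l1_eq_natCast abs_apply_le_sum_natAbs supNorm_le_add_of_box)
open Summit.QuantumFields.BalabanUV.Beta.FP.ExpLocalisedBubble
open Summit.QuantumFields.BalabanUV.Beta.FP.ExpLocalisedBubblePoint (quarter_bounds nonneg_of_decay_pow)
open DyadicShell (Pt supNorm supNorm_eq_zero_iff)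

variable {D : ℕ}

/-! ## §1 Lattice-path letters: mixed second differences of a one-point `F` and of a two-point `R` -/

/-- [folklore] **MIXED SECOND DIFFERENCE FROM UNIT SECOND DIFFERENCES ON A BOX**: if `|s_i| ≤ R₁`, `|s′_i| ≤ R₂` and the unit second differences of `F` are
`≤ B` on the coordinate box of radius `R₁ + R₂` around `y`, then `|F(y+s+s′) − F(y+s) − F(y+s′) + F y| ≤ (D·R₁)·(D·R₂·B)` (two nested lattice paths). -/
theorem abs_mixedDiff_le_of_box {F : Site D → ℝ} {y s s' : Site D} {R₁ R₂ : ℕ} (hs : ∀ i, |s i| ≤ (R₁ : ℤ)) (hs' : ∀ i, |s' i| ≤ (R₂ : ℤ))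
    {B : ℝ} (hB : 0 ≤ B)
    (h : ∀ x : Site D, (∀ i, |x i - y i| ≤ ((R₁ + R₂ : ℕ) : ℤ)) →
      ∀ i j, |Δ_[(Pi.single i 1 : Site D)] (Δ_[(Pi.single j 1 : Site D)] F) x| ≤ B) :
    |F (y + s + s') - F (y + s) - F (y + s') + F y| ≤ (D : ℝ) * (R₁ : ℝ) * ((D : ℝ) * (R₂ : ℝ) * B) := by
  set G : Site D → ℝ := fun v => F (v + s') - F v with hG
  have e : F (y + s + s') - F (y + s) - F (y + s') + F y = G (y + s) - G y := by simp only [hG]; ring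
  rw [e]
  refine abs_taylor0D_le (f := G) (p := y) (s := s) hs (by positivity) (fun x hx i => ?_)
  have e2 : Δ_[(Pi.single i 1 : Site D)] G x
      = (Δ_[(Pi.single i 1 : Site D)] F) (x + s') - (Δ_[(Pi.single i 1 : Site D)] F) x := by
    simp only [hG, fwdDiff, add_right_comm x (Pi.single i 1) s']
    ring
  rw [e2]
  refine abs_taylor0D_le (f := Δ_[(Pi.single i 1 : Site D)] F) (p := x) (s := s') hs' hB (fun x' hx' j => ?_)
  have hx'y : ∀ l, |x' l - y l| ≤ ((R₁ + R₂ : ℕ) : ℤ) := by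
    intro l
    have h1 := hx l; have h2 := hx' l
    rw [abs_le] at h1 h2 ⊢
    push_cast
    constructor <;> linarith
  exact h x' hx'y j i

/-- [folklore] **MIXED SECOND DIFFERENCE, NEAR∕FAR**: `|F| ≤ A₀` everywhere and unit second differences `≤ B` on the coordinate box of radius `2ρ` around `y`
(`ρ ≥ 1`) ⟹ for all displacements `s, s′` and every `k`,
`|F(y+s+s′) − F(y+s) − F(y+s′) + F y| ≤ D²·B·|s|₁·|s′|₁ + 4A₀·((|s|₁/ρ)^k + (|s′|₁/ρ)^k)`. -/
theorem abs_mixedDiff_le_near_far {F : Site D → ℝ} {y : Site D} {A₀ B : ℝ} {ρ : ℕ} (hρ : 0 < ρ) (hB : 0 ≤ B) (k : ℕ)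
    (hA : ∀ t, |F t| ≤ A₀)
    (hF2 : ∀ x : Site D, (∀ i, |x i - y i| ≤ ((2 * ρ : ℕ) : ℤ)) →
      ∀ i j, |Δ_[(Pi.single i 1 : Site D)] (Δ_[(Pi.single j 1 : Site D)] F) x| ≤ B) (s s' : Site D) :
    |F (y + s + s') - F (y + s) - F (y + s') + F y|
      ≤ (D : ℝ) ^ 2 * B * l1 s * l1 s' + 4 * A₀ * ((l1 s / ρ) ^ k + (l1 s' / ρ) ^ k) := by
  have hA0 : 0 ≤ A₀ := (abs_nonneg _).trans (hA y)
  have hl1 := l1_nonneg s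
  have hl1' := l1_nonneg s'
  have hρ' : (0 : ℝ) < ρ := by exact_mod_cast hρ
  have hR1 : ((∑ i, (s i).natAbs : ℕ) : ℝ) = l1 s := (l1_eq_natCast s).symm
  have hR2 : ((∑ i, (s' i).natAbs : ℕ) : ℝ) = l1 s' := (l1_eq_natCast s').symm
  have hnear0 : 0 ≤ (D : ℝ) ^ 2 * B * l1 s * l1 s' := by positivity
  have hfar0 : 0 ≤ 4 * A₀ * ((l1 s / ρ) ^ k + (l1 s' / ρ) ^ k) := by positivity
  have hcrude : |F (y + s + s') - F (y + s) - F (y + s') + F y| ≤ 4 * A₀ := by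
    have h1 := hA (y + s + s'); have h2 := hA (y + s); have h3 := hA (y + s'); have h4 := hA y
    calc |F (y + s + s') - F (y + s) - F (y + s') + F y|
        ≤ |F (y + s + s') - F (y + s) - F (y + s')| + |F y| := abs_add_le _ _
      _ ≤ (|F (y + s + s') - F (y + s)| + |F (y + s')|) + |F y| := by gcongr; exact abs_sub _ _
      _ ≤ ((|F (y + s + s')| + |F (y + s)|) + |F (y + s')|) + |F y| := by gcongr; exact abs_sub _ _
      _ ≤ ((A₀ + A₀) + A₀) + A₀ := by gcongr
      _ = 4 * A₀ := by ring
  by_cases hle : (∑ i, (s i).natAbs) ≤ ρ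
  · by_cases hle' : (∑ i, (s' i).natAbs) ≤ ρ
    · -- NEAR: both displacements inside the half box
      have hbox : ∀ x : Site D, (∀ i, |x i - y i| ≤ (((∑ i, (s i).natAbs) + (∑ i, (s' i).natAbs) : ℕ) : ℤ)) →
          ∀ i j, |Δ_[(Pi.single i 1 : Site D)] (Δ_[(Pi.single j 1 : Site D)] F) x| ≤ B := by
        intro x hx i j
        have hsum : (∑ i, (s i).natAbs) + (∑ i, (s' i).natAbs) ≤ 2 * ρ := by omega
        exact hF2 x (fun l => (hx l).trans (Int.ofNat_le.mpr hsum)) i j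
      have h := abs_mixedDiff_le_of_box (F := F) (y := y) (abs_apply_le_sum_natAbs s) (abs_apply_le_sum_natAbs s') hB hbox
      rw [hR1, hR2] at h
      calc |F (y + s + s') - F (y + s) - F (y + s') + F y| ≤ (D : ℝ) * l1 s * ((D : ℝ) * l1 s' * B) := h
        _ = (D : ℝ) ^ 2 * B * l1 s * l1 s' := by ring
        _ ≤ _ := le_add_of_nonneg_right hfar0
    · -- FAR in `s′`
      have h2 : (1 : ℝ) ≤ l1 s' / ρ := by
        rw [le_div_iff₀ hρ', one_mul, ← hR2]
        exact_mod_cast (not_le.mp hle').le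
      calc |F (y + s + s') - F (y + s) - F (y + s') + F y| ≤ 4 * A₀ := hcrude
        _ ≤ 4 * A₀ * (l1 s' / ρ) ^ k := le_mul_of_one_le_right (by positivity) (one_le_pow₀ h2)
        _ ≤ 4 * A₀ * ((l1 s / ρ) ^ k + (l1 s' / ρ) ^ k) :=
            mul_le_mul_of_nonneg_left (le_add_of_nonneg_left (by positivity)) (by positivity)
        _ ≤ _ := le_add_of_nonneg_left hnear0
  · -- FAR in `s`
    have h2 : (1 : ℝ) ≤ l1 s / ρ := by
      rw [le_div_iff₀ hρ', one_mul, ← hR1]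
      exact_mod_cast (not_le.mp hle).le
    calc |F (y + s + s') - F (y + s) - F (y + s') + F y| ≤ 4 * A₀ := hcrude
      _ ≤ 4 * A₀ * (l1 s / ρ) ^ k := le_mul_of_one_le_right (by positivity) (one_le_pow₀ h2)
      _ ≤ 4 * A₀ * ((l1 s / ρ) ^ k + (l1 s' / ρ) ^ k) :=
          mul_le_mul_of_nonneg_left (le_add_of_nonneg_right (by positivity)) (by positivity)
      _ ≤ _ := le_add_of_nonneg_left hnear0

section TwoPoint

variable {R : Site D → Site D → ℝ} {B₁ B₂ : ℝ}

/-- [folklore] **TWO-POINT LEG, FIRST ARGUMENT**: GLOBAL unit first differences `|R (u+e_i) w − R u w| ≤ B₁` ⟹ `|R u w − R 0 w| ≤ D·B₁·|u|₁` (a lattice path). -/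
theorem abs_sub_fst_le (hB : 0 ≤ B₁) (h : ∀ (u w : Site D) (i : Fin D), |R (u + Pi.single i 1) w - R u w| ≤ B₁) (u w : Site D) :
    |R u w - R 0 w| ≤ (D : ℝ) * B₁ * l1 u := by
  have hp := abs_taylor0D_le (f := fun v => R v w) (p := 0) (s := u) (abs_apply_le_sum_natAbs u) hB
    (fun x _ i => by simpa only [fwdDiff] using h x w i)
  rw [zero_add, ← l1_eq_natCast] at hp
  calc |R u w - R 0 w| ≤ (D : ℝ) * l1 u * B₁ := hp
    _ = (D : ℝ) * B₁ * l1 u := by ring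

/-- [folklore] **TWO-POINT LEG, SECOND ARGUMENT**: GLOBAL unit first differences `|R u (w+e_j) − R u w| ≤ B₁` ⟹ `|R u (w + w′) − R u w| ≤ D·B₁·|w′|₁`. -/
theorem abs_sub_snd_le (hB : 0 ≤ B₁) (h : ∀ (u w : Site D) (j : Fin D), |R u (w + Pi.single j 1) - R u w| ≤ B₁) (u w w' : Site D) :
    |R u (w + w') - R u w| ≤ (D : ℝ) * B₁ * l1 w' := by
  have hp := abs_taylor0D_le (f := fun v => R u v) (p := w) (s := w') (abs_apply_le_sum_natAbs w') hB
    (fun x _ j => by simpa only [fwdDiff] using h u x j)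
  rw [← l1_eq_natCast] at hp
  calc |R u (w + w') - R u w| ≤ (D : ℝ) * l1 w' * B₁ := hp
    _ = (D : ℝ) * B₁ * l1 w' := by ring

/-- [folklore] **TWO-POINT LEG, MIXED SECOND DIFFERENCE (one step in EACH argument)**: GLOBAL letters
`|R (u+e_i) (w+e_j) − R u (w+e_j) − R (u+e_i) w + R u w| ≤ B₂` ⟹ `|R u (w+w′) − R 0 (w+w′) − R u w + R 0 w| ≤ (D·|u|₁)·(D·|w′|₁·B₂)` (two nested paths). -/
theorem abs_mixedDiff₂_le (hB : 0 ≤ B₂)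
    (h : ∀ (u w : Site D) (i j : Fin D),
      |R (u + Pi.single i 1) (w + Pi.single j 1) - R u (w + Pi.single j 1) - R (u + Pi.single i 1) w + R u w| ≤ B₂) (u w w' : Site D) :
    |R u (w + w') - R 0 (w + w') - R u w + R 0 w| ≤ (D : ℝ) * l1 u * ((D : ℝ) * l1 w' * B₂) := by
  set G : Site D → ℝ := fun v => R v (w + w') - R v w with hG
  have e : R u (w + w') - R 0 (w + w') - R u w + R 0 w = G (0 + u) - G 0 := by simp only [hG, zero_add]; ring
  rw [e]
  have hp := abs_taylor0D_le (f := G) (p := 0) (s := u) (abs_apply_le_sum_natAbs u)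
    (mul_nonneg (mul_nonneg (Nat.cast_nonneg _) (l1_nonneg w')) hB)
    (fun x _ i => by
      have e2 : Δ_[(Pi.single i 1 : Site D)] G x
          = (fun v => R (x + Pi.single i 1) v - R x v) (w + w') - (fun v => R (x + Pi.single i 1) v - R x v) w := by
        simp only [hG, fwdDiff]; ring
      rw [e2]
      have hq := abs_taylor0D_le (f := fun v => R (x + Pi.single i 1) v - R x v) (p := w) (s := w') (abs_apply_le_sum_natAbs w') hB
        (fun x' _ j => by
          have e3 : Δ_[(Pi.single j 1 : Site D)] (fun v => R (x + Pi.single i 1) v - R x v) x'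
              = R (x + Pi.single i 1) (x' + Pi.single j 1) - R x (x' + Pi.single j 1) - R (x + Pi.single i 1) x' + R x x' := by
            simp only [fwdDiff]; ring
          rw [e3]; exact h x x' i j)
      rw [← l1_eq_natCast] at hq
      exact hq)
  rw [← l1_eq_natCast] at hp
  exact hp

end TwoPoint

/-! ## §2 The outer bookkeeping on `ℤ⁴`: box geometry, box letters, differences of `F` against letters -/

/-- [folklore] GEOMETRY OF THE DOUBLED NEAR BOX: `‖z‖∞ ≥ 4`, `|t_i − z_i| ≤ 2⌊‖z‖∞/4⌋` for all `i` ⟹ `‖z‖∞ + 1 ≤ 2·(‖t‖∞ + 1)`. -/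
theorem box_geometry_two {z t : Pt} (hz : 4 ≤ supNorm z) (ht : ∀ i, |t i - z i| ≤ ((2 * (supNorm z / 4) : ℕ) : ℤ)) :
    (supNorm z : ℝ) + 1 ≤ 2 * ((supNorm t : ℝ) + 1) := by
  obtain ⟨_, h4, _⟩ := quarter_bounds hz
  have hbox := supNorm_le_add_of_box ht
  have h : supNorm z + 1 ≤ 2 * (supNorm t + 1) := by omega
  exact_mod_cast h

/-- [folklore] `‖z‖∞ ≥ 4` ⟹ `‖z‖∞ + 1 ≤ 20·⌊‖z‖∞/4⌋` (so `1/ρ ≤ 20/(‖z‖∞+1)` and `1/(2ρ) ≤ 10/(‖z‖∞+1)`). -/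
theorem succ_le_twenty_mul_quarter {z : Pt} (hz : 4 ≤ supNorm z) : (supNorm z : ℝ) + 1 ≤ 20 * ((supNorm z / 4 : ℕ) : ℝ) := by
  obtain ⟨h1, _, h16⟩ := quarter_bounds hz
  have h : supNorm z + 1 ≤ 20 * (supNorm z / 4) := by omega
  exact_mod_cast h

section Point

variable {c₀ c₁ : Pt × Pt → ℝ} {F : Pt → ℝ} {R : Pt → Pt → ℝ} {C₀ C₁ δ A₀ A₁ A₂ B₀ B₁ B₂ : ℝ} {a : ℕ}

/-- [folklore] THE BOX LETTER OF THE FIRST DIFFERENCES: `|Δ_iF t| ≤ A₁/(‖t‖∞+1)^{a+1}` everywhere and `‖z‖∞ ≥ 4` ⟹ on the coordinate box of radius `2⌊‖z‖∞/4⌋`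
around `z`, `|F(t+e_i) − F t| ≤ A₁·2^{a+1}/(‖z‖∞+1)^{a+1}`. -/
theorem fwdDiff_box_le (hF1 : ∀ (t : Pt) (i : Fin 4), |Δ_[(Pi.single i 1 : Pt)] F t| ≤ A₁ / ((supNorm t : ℝ) + 1) ^ (a + 1))
    {z : Pt} (hz : 4 ≤ supNorm z) (t : Pt) (ht : ∀ i, |t i - z i| ≤ ((2 * (supNorm z / 4) : ℕ) : ℤ)) (i : Fin 4) :
    |F (t + Pi.single i 1) - F t| ≤ A₁ * 2 ^ (a + 1) / ((supNorm z : ℝ) + 1) ^ (a + 1) := by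
  have hA1 : 0 ≤ A₁ := nonneg_of_decay_pow (fun t => hF1 t 0)
  have h := hF1 t i
  rw [fwdDiff] at h
  refine h.trans ?_
  rw [div_le_div_iff₀ (by positivity) (by positivity)]
  have key : ((supNorm z : ℝ) + 1) ^ (a + 1) ≤ (2 * ((supNorm t : ℝ) + 1)) ^ (a + 1) :=
    pow_le_pow_left₀ (by positivity) (box_geometry_two hz ht) _
  rw [mul_pow] at key
  calc A₁ * ((supNorm z : ℝ) + 1) ^ (a + 1) ≤ A₁ * (2 ^ (a + 1) * ((supNorm t : ℝ) + 1) ^ (a + 1)) := mul_le_mul_of_nonneg_left key hA1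
    _ = A₁ * 2 ^ (a + 1) * ((supNorm t : ℝ) + 1) ^ (a + 1) := by ring

/-- [folklore] THE BOX LETTER OF THE SECOND DIFFERENCES: `|Δ_iΔ_jF t| ≤ A₂/(‖t‖∞+1)^{a+2}` everywhere and `‖z‖∞ ≥ 4` ⟹ on the box of radius `2⌊‖z‖∞/4⌋` around `z`,
`|Δ_iΔ_jF t| ≤ A₂·2^{a+2}/(‖z‖∞+1)^{a+2}`. -/
theorem fwdDiff₂_box_le
    (hF2 : ∀ (t : Pt) (i j : Fin 4), |Δ_[(Pi.single i 1 : Pt)] (Δ_[(Pi.single j 1 : Pt)] F) t| ≤ A₂ / ((supNorm t : ℝ) + 1) ^ (a + 2))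
    {z : Pt} (hz : 4 ≤ supNorm z) (t : Pt) (ht : ∀ i, |t i - z i| ≤ ((2 * (supNorm z / 4) : ℕ) : ℤ)) (i j : Fin 4) :
    |Δ_[(Pi.single i 1 : Pt)] (Δ_[(Pi.single j 1 : Pt)] F) t| ≤ A₂ * 2 ^ (a + 2) / ((supNorm z : ℝ) + 1) ^ (a + 2) := by
  have hA2 : 0 ≤ A₂ := nonneg_of_decay_pow (fun t => hF2 t 0 0)
  refine (hF2 t i j).trans ?_
  rw [div_le_div_iff₀ (by positivity) (by positivity)]
  have key : ((supNorm z : ℝ) + 1) ^ (a + 2) ≤ (2 * ((supNorm t : ℝ) + 1)) ^ (a + 2) :=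
    pow_le_pow_left₀ (by positivity) (box_geometry_two hz ht) _
  rw [mul_pow] at key
  calc A₂ * ((supNorm z : ℝ) + 1) ^ (a + 2) ≤ A₂ * (2 ^ (a + 2) * ((supNorm t : ℝ) + 1) ^ (a + 2)) := mul_le_mul_of_nonneg_left key hA2
    _ = A₂ * 2 ^ (a + 2) * ((supNorm t : ℝ) + 1) ^ (a + 2) := by ring

/-- [folklore] The far penalty against the letter: `‖z‖∞ ≥ 4`, `ρ = ⌊‖z‖∞/4⌋`, `c·ρ' ≥ ‖z‖∞+1` ⟹ `(l/ρ')^m ≤ l^m·c^m/(‖z‖∞+1)^m`. -/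
theorem div_pow_le_of_succ_le {l ρ' c n : ℝ} (hl : 0 ≤ l) (hρ : 0 < ρ') (hn : 0 < n + 1) (hc : n + 1 ≤ c * ρ') (m : ℕ) :
    (l / ρ') ^ m ≤ l ^ m * (c ^ m / (n + 1) ^ m) := by
  have hc0 : 0 ≤ c := by
    by_contra h
    push Not at h
    have : c * ρ' < 0 := mul_neg_of_neg_of_pos h hρ
    linarith
  have h1 : l / ρ' ≤ l * (c / (n + 1)) := by
    rw [div_eq_mul_one_div]
    refine mul_le_mul_of_nonneg_left ?_ hl
    rw [div_le_div_iff₀ hρ hn, one_mul]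
    exact hc
  calc (l / ρ') ^ m ≤ (l * (c / (n + 1))) ^ m := pow_le_pow_left₀ (by positivity) h1 _
    _ = l ^ m * (c ^ m / (n + 1) ^ m) := by rw [mul_pow, div_pow]

/-- [folklore] **OUTER FIRST DIFFERENCE OF `F` AGAINST A LETTER**: `‖z‖∞ ≥ 4`, graded letters `A₀` (exponent `a`) and `A₁` (exponent `a+1`) ⟹ for every displacement `s`
and every `L ≥ max(1, |s|₁)`, `|F(z+s) − F z| ≤ (4·A₁2^{a+1}/(‖z‖∞+1)^{a+1} + 2A₀·10^{a+1}/(‖z‖∞+1)^{a+1})·L^{a+2}` (near radius `2⌊‖z‖∞/4⌋`, far exponent `a+1`). -/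
theorem abs_sub_le_outer (hF0 : ∀ t : Pt, |F t| ≤ A₀ / ((supNorm t : ℝ) + 1) ^ a)
    (hF1 : ∀ (t : Pt) (i : Fin 4), |Δ_[(Pi.single i 1 : Pt)] F t| ≤ A₁ / ((supNorm t : ℝ) + 1) ^ (a + 1))
    {z : Pt} (hz : 4 ≤ supNorm z) (s : Pt) {L : ℝ} (hL : 1 ≤ L) (hsL : l1 s ≤ L) :
    |F (z + s) - F z|
      ≤ (4 * (A₁ * 2 ^ (a + 1) / ((supNorm z : ℝ) + 1) ^ (a + 1)) + 2 * A₀ * (10 ^ (a + 1) / ((supNorm z : ℝ) + 1) ^ (a + 1))) * L ^ (a + 2) := by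
  have hA0 := nonneg_of_decay_pow hF0
  have hA1 : 0 ≤ A₁ := nonneg_of_decay_pow (fun t => hF1 t 0)
  have hFA : ∀ t, |F t| ≤ A₀ := fun t => (hF0 t).trans (div_le_self hA0 (one_le_pow₀ (by
    have := (Nat.cast_nonneg (supNorm t) : (0:ℝ) ≤ _); linarith)))
  obtain ⟨hρ1, hρ4, hρ16⟩ := quarter_bounds hz
  set n : ℝ := (supNorm z : ℝ) with hn
  have hn0 : 0 ≤ n := by positivity
  have hn1 : 0 < n + 1 := by linarith
  have h2ρpos : 0 < 2 * (supNorm z / 4) := by omega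
  have h2ρpos' : (0 : ℝ) < ((2 * (supNorm z / 4) : ℕ) : ℝ) := by exact_mod_cast h2ρpos
  have h10 : n + 1 ≤ 10 * ((2 * (supNorm z / 4) : ℕ) : ℝ) := by
    have h := succ_le_twenty_mul_quarter hz
    push_cast at h ⊢; linarith
  set b₁ : ℝ := A₁ * 2 ^ (a + 1) / (n + 1) ^ (a + 1) with hb₁
  have hb₁0 : 0 ≤ b₁ := by positivity
  have hs0 := l1_nonneg s
  have h := abs_sub_le_near_far_pow (D := 4) (y := z) h2ρpos hb₁0 (a + 1) hFA (fun t ht i => fwdDiff_box_le hF1 hz t ht i) s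
  rw [show ((4 : ℕ) : ℝ) = 4 by norm_num] at h
  refine h.trans ?_
  have t1 : 4 * b₁ * l1 s ≤ 4 * b₁ * L ^ (a + 2) :=
    mul_le_mul_of_nonneg_left ((pow_one (l1 s)).symm.le.trans (((pow_le_pow_left₀ hs0 hsL _).trans (pow_le_pow_right₀ hL (by omega))))) (by positivity)
  have t2 : 2 * A₀ * (l1 s / ((2 * (supNorm z / 4) : ℕ) : ℝ)) ^ (a + 1) ≤ 2 * A₀ * (10 ^ (a + 1) / (n + 1) ^ (a + 1)) * L ^ (a + 2) := by
    have h' := (div_pow_le_of_succ_le hs0 h2ρpos' hn1 h10 (a + 1)).trans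
      (mul_le_mul_of_nonneg_right (((pow_le_pow_left₀ hs0 hsL _).trans (pow_le_pow_right₀ hL (by omega : a + 1 ≤ a + 2))))
        (by positivity : (0:ℝ) ≤ 10 ^ (a + 1) / (n + 1) ^ (a + 1)))
    calc 2 * A₀ * (l1 s / ((2 * (supNorm z / 4) : ℕ) : ℝ)) ^ (a + 1) ≤ 2 * A₀ * (L ^ (a + 2) * (10 ^ (a + 1) / (n + 1) ^ (a + 1))) :=
          mul_le_mul_of_nonneg_left h' (by positivity)
      _ = _ := by ring
  calc 4 * b₁ * l1 s + 2 * A₀ * (l1 s / ((2 * (supNorm z / 4) : ℕ) : ℝ)) ^ (a + 1)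
      ≤ 4 * b₁ * L ^ (a + 2) + 2 * A₀ * (10 ^ (a + 1) / (n + 1) ^ (a + 1)) * L ^ (a + 2) := add_le_add t1 t2
    _ = _ := by ring

/-- [folklore] **OUTER MIXED SECOND DIFFERENCE OF `F` AGAINST TWO LETTERS**: `‖z‖∞ ≥ 4`, graded letters `A₀` (exponent `a`), `A₂` (exponent `a+2`) ⟹ for displacements
`y, x′` and letters `L₀ ≥ max(1,|y|₁)`, `L₁ ≥ max(1,|x′|₁)`,
`|F(z+x′−y) − F(z+x′) − F(z−y) + F z| ≤ (16·A₂2^{a+2}/(‖z‖∞+1)^{a+2} + 8A₀·20^{a+2}/(‖z‖∞+1)^{a+2})·L₀^{a+2}·L₁^{a+2}`. -/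
theorem abs_mixedDiff_le_outer (hF0 : ∀ t : Pt, |F t| ≤ A₀ / ((supNorm t : ℝ) + 1) ^ a)
    (hF2 : ∀ (t : Pt) (i j : Fin 4), |Δ_[(Pi.single i 1 : Pt)] (Δ_[(Pi.single j 1 : Pt)] F) t| ≤ A₂ / ((supNorm t : ℝ) + 1) ^ (a + 2))
    {z : Pt} (hz : 4 ≤ supNorm z) (y x' : Pt) {L₀ L₁ : ℝ} (hL₀ : 1 ≤ L₀) (hL₁ : 1 ≤ L₁) (hyL : l1 y ≤ L₀) (hxL : l1 x' ≤ L₁) :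
    |F (z + x' - y) - F (z + x') - F (z - y) + F z|
      ≤ (16 * (A₂ * 2 ^ (a + 2) / ((supNorm z : ℝ) + 1) ^ (a + 2)) + 8 * A₀ * (20 ^ (a + 2) / ((supNorm z : ℝ) + 1) ^ (a + 2)))
        * (L₀ ^ (a + 2) * L₁ ^ (a + 2)) := by
  have hA0 := nonneg_of_decay_pow hF0
  have hA2 : 0 ≤ A₂ := nonneg_of_decay_pow (fun t => hF2 t 0 0)
  have hFA : ∀ t, |F t| ≤ A₀ := fun t => (hF0 t).trans (div_le_self hA0 (one_le_pow₀ (by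
    have := (Nat.cast_nonneg (supNorm t) : (0:ℝ) ≤ _); linarith)))
  obtain ⟨hρ1, hρ4, hρ16⟩ := quarter_bounds hz
  set n : ℝ := (supNorm z : ℝ) with hn
  have hn0 : 0 ≤ n := by positivity
  have hn1 : 0 < n + 1 := by linarith
  have hρpos : (0 : ℝ) < ((supNorm z / 4 : ℕ) : ℝ) := by exact_mod_cast hρ1
  have h20 : n + 1 ≤ 20 * ((supNorm z / 4 : ℕ) : ℝ) := succ_le_twenty_mul_quarter hz
  set b₂ : ℝ := A₂ * 2 ^ (a + 2) / (n + 1) ^ (a + 2) with hb₂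
  have hb₂0 : 0 ≤ b₂ := by positivity
  have hy0 := l1_nonneg y; have hx0 := l1_nonneg x'
  have hPK₀ : 1 ≤ L₀ ^ (a + 2) := one_le_pow₀ hL₀
  have hPK₁ : 1 ≤ L₁ ^ (a + 2) := one_le_pow₀ hL₁
  have hl1neg : l1 (-y) = l1 y := by rw [← zero_sub, l1_sub_symm, sub_zero]
  have h := abs_mixedDiff_le_near_far (D := 4) (y := z) hρ1 hb₂0 (a + 2) hFA (fun t ht i j => fwdDiff₂_box_le hF2 hz t ht i j) (-y) x'
  rw [hl1neg, show ((4 : ℕ) : ℝ) = 4 by norm_num] at h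
  have e : F (z + -y + x') - F (z + -y) - F (z + x') + F z = F (z + x' - y) - F (z + x') - F (z - y) + F z := by
    rw [← sub_eq_add_neg, sub_add_eq_add_sub]; ring
  rw [e] at h
  refine h.trans ?_
  have t1 : (4 : ℝ) ^ 2 * b₂ * l1 y * l1 x' ≤ 16 * b₂ * (L₀ ^ (a + 2) * L₁ ^ (a + 2)) := by
    rw [show (4 : ℝ) ^ 2 * b₂ * l1 y * l1 x' = 16 * b₂ * (l1 y * l1 x') by ring]
    refine mul_le_mul_of_nonneg_left (mul_le_mul ?_ ?_ hx0 (by positivity)) (by positivity)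
    · exact (pow_one (l1 y)).symm.le.trans (((pow_le_pow_left₀ hy0 hyL _).trans (pow_le_pow_right₀ hL₀ (by omega))))
    · exact (pow_one (l1 x')).symm.le.trans (((pow_le_pow_left₀ hx0 hxL _).trans (pow_le_pow_right₀ hL₁ (by omega))))
  have t2 : 4 * A₀ * ((l1 y / ((supNorm z / 4 : ℕ) : ℝ)) ^ (a + 2) + (l1 x' / ((supNorm z / 4 : ℕ) : ℝ)) ^ (a + 2))
      ≤ 8 * A₀ * (20 ^ (a + 2) / (n + 1) ^ (a + 2)) * (L₀ ^ (a + 2) * L₁ ^ (a + 2)) := by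
    have hy' : (l1 y / ((supNorm z / 4 : ℕ) : ℝ)) ^ (a + 2) ≤ L₀ ^ (a + 2) * L₁ ^ (a + 2) * (20 ^ (a + 2) / (n + 1) ^ (a + 2)) :=
      (div_pow_le_of_succ_le hy0 hρpos hn1 h20 (a + 2)).trans (mul_le_mul_of_nonneg_right
        ((((pow_le_pow_left₀ hy0 hyL _).trans (pow_le_pow_right₀ hL₀ le_rfl))).trans (le_mul_of_one_le_right (by positivity) hPK₁)) (by positivity))
    have hx'' : (l1 x' / ((supNorm z / 4 : ℕ) : ℝ)) ^ (a + 2) ≤ L₀ ^ (a + 2) * L₁ ^ (a + 2) * (20 ^ (a + 2) / (n + 1) ^ (a + 2)) :=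
      (div_pow_le_of_succ_le hx0 hρpos hn1 h20 (a + 2)).trans (mul_le_mul_of_nonneg_right
        ((((pow_le_pow_left₀ hx0 hxL _).trans (pow_le_pow_right₀ hL₁ le_rfl))).trans (le_mul_of_one_le_left (by positivity) hPK₀)) (by positivity))
    calc 4 * A₀ * ((l1 y / ((supNorm z / 4 : ℕ) : ℝ)) ^ (a + 2) + (l1 x' / ((supNorm z / 4 : ℕ) : ℝ)) ^ (a + 2))
        ≤ 4 * A₀ * (L₀ ^ (a + 2) * L₁ ^ (a + 2) * (20 ^ (a + 2) / (n + 1) ^ (a + 2))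
            + L₀ ^ (a + 2) * L₁ ^ (a + 2) * (20 ^ (a + 2) / (n + 1) ^ (a + 2))) :=
          mul_le_mul_of_nonneg_left (add_le_add hy' hx'') (by positivity)
      _ = _ := by ring
  calc (4 : ℝ) ^ 2 * b₂ * l1 y * l1 x' + 4 * A₀ * ((l1 y / ((supNorm z / 4 : ℕ) : ℝ)) ^ (a + 2) + (l1 x' / ((supNorm z / 4 : ℕ) : ℝ)) ^ (a + 2))
      ≤ 16 * b₂ * (L₀ ^ (a + 2) * L₁ ^ (a + 2)) + 8 * A₀ * (20 ^ (a + 2) / (n + 1) ^ (a + 2)) * (L₀ ^ (a + 2) * L₁ ^ (a + 2)) :=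
        add_le_add t1 t2
    _ = _ := by ring

end Point

end Summit.QuantumFields.BalabanUV.Beta.FP.NearRegionCrossBubbleLetters

end
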